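import Literature.NumberTheory.ComplexMultiplication.CMTypeRankCommonConstituent
import Literature.AlgebraicGeometry.Pohlmann1968.CMFamilyRankSlots
import HarnessLib

/-!
# The rank of a family of CM types along a PARTITION of its slots: rank additivity and nondegeneracy are decided
# PAIRWISE BETWEEN THE BLOCKS

Companion of `NumberTheory/ComplexMultiplication/CMTypeRankFamilies` (the family type `Σ = sigmaType Φ ⊆ ⊔_i E_i` of a
family `Φ_i ⊆ E_i` of CM types for a conjugation `ρ ∈ G`, `typeRank G Σ`; on abelian varieties `rank(Σ) − 1 =
dim Hg(∏_i A_{Φ_i})`), of `…/CMTypeRankCommonConstituent` (the PAIRWISE criterion between SLOTS: if for all `i ≠ j` the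
`G`-modules `U(Φ_i)`, `U(Φ_j)` have no common constituent — e.g. some `σ ∈ G` is `ρ` on `E_i` and trivial on `E_j`,
`pairwise_of_partialConj` — then `rank(Σ) + |I| = Σ_i rank(Φ_i) + 1` and `Σ` is nondegenerate iff every member is) and of
`AlgebraicGeometry/Pohlmann1968/CMFamilyRankSlots` (`typeRank_preimage_eq_of_surjective`: Kubota's rank along an
equivariant surjection of index sets).

Here the slots are grouped into BLOCKS along an arbitrary map `κ : I → C` (block `c` = the slots `i` with `κ i = c`).
The family REGROUPED along `κ` is the family, indexed by `C`, whose member at `c` is the family type of the sub-family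
`(Φ_i)_{κ i = c}` on the `G`-set `⊔_{κ i = c} E_i`; its family type is the family type of `Φ` read through the
equivariant bijection `(c, (i, s)) ↦ (i, s)`:

* `typeRank_sigmaType_fiber` — **regrouping does not change the rank**: `rank(⊔_c Σ|_c) = rank(Σ)`;
  `card_sigma_fiber` — nor the number of embeddings;
* `typeRank_sigmaType_add_card_eq_of_pairwise_fiber`, `typeRank_sigmaType_eq_iff_forall_fiber_of_pairwise` — **the
  pairwise criterion BETWEEN BLOCKS**: if for all blocks `c ≠ c'` the modules `U(Σ|_c)`, `U(Σ|_{c'})` have no common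
  constituent, then `rank(Σ) + |C| = Σ_c rank(Σ|_c) + 1` (`Hg(∏_i A_i) = ∏_c Hg(∏_{κ i = c} A_i)`) and `Σ` is
  nondegenerate iff EVERY BLOCK SUB-FAMILY `Σ|_c` is;
* `pairwise_fiber_of_partialConj` — the sufficient condition: for every ordered pair of distinct blocks `c ≠ c'` some
  `σ ∈ G` acts as `ρ` on every slot of `c` and trivially on every slot of `c'` (NOTHING is asked on the remaining blocks);
  `typeRank_sigmaType_add_card_eq_of_partialConj_fiber`, `typeRank_sigmaType_eq_iff_forall_fiber_of_partialConj` — the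
  two statements under this condition.

For `G = Aut(ℂ)` on `E_i = Hom(K_i, ℂ)` such a `σ` exists iff complex conjugation fixes `L_c ∩ L_{c'}`, `L_c` the
compositum of the Galois closures of the fields of block `c` (number-field dress:
`AlgebraicGeometry/Pohlmann1968/CMFamilyRankPartition`).  This is STRICTLY WEAKER than each of the tree's earlier
sufficient conditions, all of which it contains: slotwise independence (`typeRank_sigmaType_eq_iff_forall`), one partial
conjugation per slot trivial on ALL other slots at once (`…/CMTypeRankPartialConjugation`, blocks = singletons and the
`σ` independent of `c'`), the pairwise criterion between slots (`…/CMTypeRankCommonConstituent`, `κ = id`), and the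
two-block splitting along composita (`…/CMTypeRankTwoBlocksPartialConj`, `|C| = 2`).  It is the form needed when several
slots SHARE all their constituents (two simple CM abelian surfaces whose quartic CM fields have the same dihedral Galois
closure: `U(Φ_i) ≅ U(Φ_j)` is the `2`-dimensional representation of `D₄`, so no criterion between those two SLOTS can
hold, while the PAIR is still nondegenerate and separates from every other closure class by a partial conjugation).

Everything is proved; no definition (the regrouping map is written out), no named fact, no `sorry`.  On Hodge groups
(Deligne, LNM 900, I Ex. 3.7 (c); Moonen–Zarhin 1999 §3 (3.1)) the main statement reads: if `Hg(X_c × X_{c'}) =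
Hg(X_c) × Hg(X_{c'})` is witnessed by a partial conjugation for all `c ≠ c'`, then `Hg(∏_c X_c) = ∏_c Hg(X_c)` — the
valid "pairs-to-products" step for CM Hodge groups (which, being TORI, admit no Goursat–Ribet lemma: pairwise splitting
alone does NOT imply total splitting, cf. the dihedral surface triple of `Summits/…/CorCM/DihedralReflexTripleRank`).

## References
* [Gordon1999HodgeAVSurvey] B. B. Gordon, *A survey of the Hodge conjecture for abelian varieties*, §3 Theorem (Imai,
  Murty) with proof; 7.5–7.7.
* [MoonenZarhin1999LowDim] B. Moonen, Yu. Zarhin, Math. Ann. 315 (1999) 711–733, §3 (3.1), Remark (3.9).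
* [Deligne1982HodgeCycles] P. Deligne, *Hodge cycles on abelian varieties*, LNM 900 (1982), I Ex. 3.7.
-/

set_option autoImplicit false

noncomputable section

open scoped BigOperators

namespace Literature.NumberTheory.ComplexMultiplication

variable {G : Type*} [Group G] {I : Type*} {E : I → Type*} [∀ i, MulAction G (E i)] {C : Type*}

/-! ### Regrouping a family along `κ : I → C` -/

section Regroup

/-- Membership in the family type of the regrouped family: `(c, (i, s)) ∈ ⊔_c Σ|_c ↔ s ∈ Φ_i`.
[cite: Deligne1982HodgeCycles, I Ex. 3.7 (p. 25)] -/
theorem mem_sigmaType_fiber_iff (Φ : ∀ i, Set (E i)) (κ : I → C) (x : Σ c, Σ i : {i // κ i = c}, E i.1) :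
    x ∈ sigmaType (fun c => sigmaType fun i : {i // κ i = c} => Φ i.1) ↔ x.2.2 ∈ Φ x.2.1.1 :=
  Iff.rfl

/-- The regrouping map `(c, (i, s)) ↦ (i, s)` is `G`-equivariant (the action is slot by slot on both sides). [folklore] -/
private theorem regroup_smul (κ : I → C) (g : G) (x : Σ c, Σ i : {i // κ i = c}, E i.1) :
    (⟨(g • x).2.1.1, (g • x).2.2⟩ : Σ i, E i) = g • (⟨x.2.1.1, x.2.2⟩ : Σ i, E i) :=
  rfl

/-- The regrouping map `(c, (i, s)) ↦ (i, s)` is surjective (`(i, s)` comes from the block `κ i`). [folklore] -/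
private theorem regroup_surjective (κ : I → C) :
    Function.Surjective fun x : (Σ c, Σ i : {i // κ i = c}, E i.1) => (⟨x.2.1.1, x.2.2⟩ : Σ i, E i) :=
  fun y => ⟨⟨κ y.1, ⟨y.1, rfl⟩, y.2⟩, rfl⟩

/-- **The family type of the regrouped family is the family type of `Φ` read through the regrouping map.**
[cite: Deligne1982HodgeCycles, I Ex. 3.7 (p. 25)] -/
theorem preimage_regroup_sigmaType (Φ : ∀ i, Set (E i)) (κ : I → C) :
    (fun x : (Σ c, Σ i : {i // κ i = c}, E i.1) => (⟨x.2.1.1, x.2.2⟩ : Σ i, E i)) ⁻¹' sigmaType Φ =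
      sigmaType (fun c => sigmaType fun i : {i // κ i = c} => Φ i.1) :=
  rfl

/-- **Regrouping does not change the rank**: `rank(⊔_c Σ|_c) = rank(Σ)` (Kubota's rank along the equivariant
bijection `(c, (i, s)) ↦ (i, s)`; on Mumford–Tate groups: `∏_c ∏_{κ i = c} A_i ≅ ∏_i A_i`).
[cite: Gordon1999HodgeAVSurvey, 7.7] -/
theorem typeRank_sigmaType_fiber (Φ : ∀ i, Set (E i)) (κ : I → C) :
    typeRank G (sigmaType fun c => sigmaType fun i : {i // κ i = c} => Φ i.1) = typeRank G (sigmaType Φ) := by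
  rw [← preimage_regroup_sigmaType Φ κ]
  exact typeRank_preimage_eq_of_surjective (G := G) (sigmaType Φ) _ (fun g x => regroup_smul κ g x)
    (regroup_surjective κ)

/-- Regrouping does not change the number of embeddings: `|⊔_c ⊔_{κ i = c} E_i| = |⊔_i E_i|` (Deligne's
`S = Hom(∏_i K_i, ℂ) = ⊔_i Hom(K_i, ℂ)`, counted block by block). [cite: Deligne1982HodgeCycles, I Ex. 3.7 (p. 25)] -/
theorem card_sigma_fiber [Fintype I] [Fintype C] [DecidableEq C] [∀ i, Fintype (E i)] (κ : I → C) :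
    Fintype.card (Σ c, Σ i : {i // κ i = c}, E i.1) = Fintype.card (Σ i, E i) := by
  simp only [Fintype.card_sigma]
  exact Fintype.sum_fiberwise κ fun i => Fintype.card (E i)

/-- The regrouped family is a family of CM types for `ρ` when `Φ` is. [cite: Deligne1982HodgeCycles, I Ex. 3.7 (p. 25)] -/
theorem isCMTypeWith_sigmaType_fiber {ρ : G} {Φ : ∀ i, Set (E i)} (h : ∀ i, IsCMTypeWith ρ (Φ i)) (κ : I → C)
    (c : C) : IsCMTypeWith ρ (sigmaType fun i : {i // κ i = c} => Φ i.1) :=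
  IsCMTypeWith.sigmaType fun i => h i.1

end Regroup

/-! ### The pairwise criterion between blocks -/

section Pairwise

variable [Fintype I] [Fintype C] [DecidableEq C] [∀ i, Fintype (E i)] [Nonempty I] [∀ i, Nonempty (E i)]

/-- **Rank additivity over the blocks under the pairwise criterion between blocks**: if for all blocks `c ≠ c'` the
`G`-modules `U(Σ|_c)`, `U(Σ|_{c'})` have no common constituent (no non-zero `G`-stable `P ≤ U(Σ|_c)` maps equivariantly
and injectively into `U(Σ|_{c'})`), then `rank(Σ) + |C| = Σ_c rank(Σ|_c) + 1` — `Hg(∏_i A_i) = ∏_c Hg(∏_{κ i = c} A_i)`.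
[cite: Gordon1999HodgeAVSurvey, §3 Theorem (1) (proof)] [cite: MoonenZarhin1999LowDim, §3 (3.1)] -/
theorem typeRank_sigmaType_add_card_eq_of_pairwise_fiber {ρ : G} {Φ : ∀ i, Set (E i)}
    (h : ∀ i, IsCMTypeWith ρ (Φ i)) (κ : I → C) (hκ : Function.Surjective κ)
    (hpair : ∀ c c', c ≠ c' → ∀ P : Submodule ℚ ((Σ i : {i // κ i = c}, E i.1) → ℚ),
      P ≤ antiSpan G (sigmaType fun i : {i // κ i = c} => Φ i.1) →
      (∀ g : G, ∀ f ∈ P, (fun x => f (g • x)) ∈ P) →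
      ∀ T : ((Σ i : {i // κ i = c}, E i.1) → ℚ) →ₗ[ℚ] ((Σ i : {i // κ i = c'}, E i.1) → ℚ),
        (∀ g : G, ∀ f ∈ P, T (fun x => f (g • x)) = fun y => T f (g • y)) →
        (∀ f ∈ P, T f ∈ antiSpan G (sigmaType fun i : {i // κ i = c'} => Φ i.1)) →
        (∀ f ∈ P, T f = 0 → f = 0) → P = ⊥) :
    typeRank G (sigmaType Φ) + Fintype.card C =
      (∑ c, typeRank G (sigmaType fun i : {i // κ i = c} => Φ i.1)) + 1 := by
  haveI : Nonempty C := ⟨κ (Classical.arbitrary I)⟩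
  haveI : ∀ c, Nonempty (Σ i : {i // κ i = c}, E i.1) := fun c => by
    obtain ⟨i, hi⟩ := hκ c
    exact ⟨⟨⟨i, hi⟩, Classical.arbitrary (E i)⟩⟩
  have key := typeRank_sigmaType_add_card_eq_of_pairwise (G := G)
    (Φ := fun c => sigmaType fun i : {i // κ i = c} => Φ i.1) (fun c => isCMTypeWith_sigmaType_fiber h κ c) hpair
  rwa [typeRank_sigmaType_fiber] at key

/-- **Under the pairwise criterion between blocks, `Σ` is nondegenerate iff every block sub-family is**:
`rank(Σ) = |⊔_i E_i|/2 + 1 ⟺ ∀ c, rank(Σ|_c) = |⊔_{κ i = c} E_i|/2 + 1` (`∏_i A_i` is stably nondegenerate iff every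
`∏_{κ i = c} A_i` is). [cite: Gordon1999HodgeAVSurvey, §3 Theorem and 7.5] [cite: MoonenZarhin1999LowDim, §3 (3.1)] -/
theorem typeRank_sigmaType_eq_iff_forall_fiber_of_pairwise {ρ : G} {Φ : ∀ i, Set (E i)}
    (h : ∀ i, IsCMTypeWith ρ (Φ i)) (κ : I → C) (hκ : Function.Surjective κ)
    (hpair : ∀ c c', c ≠ c' → ∀ P : Submodule ℚ ((Σ i : {i // κ i = c}, E i.1) → ℚ),
      P ≤ antiSpan G (sigmaType fun i : {i // κ i = c} => Φ i.1) →
      (∀ g : G, ∀ f ∈ P, (fun x => f (g • x)) ∈ P) →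
      ∀ T : ((Σ i : {i // κ i = c}, E i.1) → ℚ) →ₗ[ℚ] ((Σ i : {i // κ i = c'}, E i.1) → ℚ),
        (∀ g : G, ∀ f ∈ P, T (fun x => f (g • x)) = fun y => T f (g • y)) →
        (∀ f ∈ P, T f ∈ antiSpan G (sigmaType fun i : {i // κ i = c'} => Φ i.1)) →
        (∀ f ∈ P, T f = 0 → f = 0) → P = ⊥) :
    typeRank G (sigmaType Φ) = Fintype.card (Σ i, E i) / 2 + 1 ↔
      ∀ c, typeRank G (sigmaType fun i : {i // κ i = c} => Φ i.1) =
        Fintype.card (Σ i : {i // κ i = c}, E i.1) / 2 + 1 := by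
  haveI : Nonempty C := ⟨κ (Classical.arbitrary I)⟩
  haveI : ∀ c, Nonempty (Σ i : {i // κ i = c}, E i.1) := fun c => by
    obtain ⟨i, hi⟩ := hκ c
    exact ⟨⟨⟨i, hi⟩, Classical.arbitrary (E i)⟩⟩
  have key := typeRank_sigmaType_eq_iff_forall_of_pairwise (G := G)
    (Φ := fun c => sigmaType fun i : {i // κ i = c} => Φ i.1) (fun c => isCMTypeWith_sigmaType_fiber h κ c) hpair
  rwa [typeRank_sigmaType_fiber, card_sigma_fiber] at key

end Pairwise

/-! ### Partial conjugations between blocks -/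

section PartialConj

/-- **A partial conjugation for every ordered pair of distinct blocks gives the pairwise criterion between blocks**: if
for all `c ≠ c'` some `σ ∈ G` acts as `ρ` on every slot of block `c` and trivially on every slot of block `c'` (nothing is
asked on the other blocks), then `U(Σ|_c)` and `U(Σ|_{c'})` have no common constituent.
[cite: Gordon1999HodgeAVSurvey, §3 Theorem (proof)] -/
theorem pairwise_fiber_of_partialConj {ρ : G} {Φ : ∀ i, Set (E i)} (h : ∀ i, IsCMTypeWith ρ (Φ i)) (κ : I → C)
    (hσ : ∀ c c', c ≠ c' → ∃ σ : G, (∀ i, κ i = c → ∀ s : E i, σ • s = ρ • s) ∧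
      (∀ i, κ i = c' → ∀ s : E i, σ • s = s)) :
    ∀ c c', c ≠ c' → ∀ P : Submodule ℚ ((Σ i : {i // κ i = c}, E i.1) → ℚ),
      P ≤ antiSpan G (sigmaType fun i : {i // κ i = c} => Φ i.1) →
      (∀ g : G, ∀ f ∈ P, (fun x => f (g • x)) ∈ P) →
      ∀ T : ((Σ i : {i // κ i = c}, E i.1) → ℚ) →ₗ[ℚ] ((Σ i : {i // κ i = c'}, E i.1) → ℚ),
        (∀ g : G, ∀ f ∈ P, T (fun x => f (g • x)) = fun y => T f (g • y)) →
        (∀ f ∈ P, T f ∈ antiSpan G (sigmaType fun i : {i // κ i = c'} => Φ i.1)) →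
        (∀ f ∈ P, T f = 0 → f = 0) → P = ⊥ := by
  intro c c' hcc'
  obtain ⟨σ, hσc, hσc'⟩ := hσ c c' hcc'
  exact (pairwise_of_partialConj (G := G) (Φ := fun c => sigmaType fun i : {i // κ i = c} => Φ i.1)
    (fun c => isCMTypeWith_sigmaType_fiber h κ c) (i := c) (j := c') (σ := σ)
    (fun x => by
      obtain ⟨⟨i, hi⟩, s⟩ := x
      change (⟨⟨i, hi⟩, σ • s⟩ : Σ i : {i // κ i = c}, E i.1) = ⟨⟨i, hi⟩, ρ • s⟩
      rw [hσc i hi s])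
    (fun x => by
      obtain ⟨⟨i, hi⟩, s⟩ := x
      change (⟨⟨i, hi⟩, σ • s⟩ : Σ i : {i // κ i = c'}, E i.1) = ⟨⟨i, hi⟩, s⟩
      rw [hσc' i hi s])).1

variable [Fintype I] [Fintype C] [DecidableEq C] [∀ i, Fintype (E i)] [Nonempty I] [∀ i, Nonempty (E i)]

/-- **Rank additivity over blocks from partial conjugations between blocks**: `rank(Σ) + |C| = Σ_c rank(Σ|_c) + 1`
(`Hg(∏_c X_c) = ∏_c Hg(X_c)` for `X_c = ∏_{κ i = c} A_i`) as soon as every ordered pair of distinct blocks carries a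
partial conjugation. [cite: Gordon1999HodgeAVSurvey, §3 Theorem (1) (proof)] [cite: MoonenZarhin1999LowDim, §3 (3.1)] -/
theorem typeRank_sigmaType_add_card_eq_of_partialConj_fiber {ρ : G} {Φ : ∀ i, Set (E i)}
    (h : ∀ i, IsCMTypeWith ρ (Φ i)) (κ : I → C) (hκ : Function.Surjective κ)
    (hσ : ∀ c c', c ≠ c' → ∃ σ : G, (∀ i, κ i = c → ∀ s : E i, σ • s = ρ • s) ∧
      (∀ i, κ i = c' → ∀ s : E i, σ • s = s)) :
    typeRank G (sigmaType Φ) + Fintype.card C =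
      (∑ c, typeRank G (sigmaType fun i : {i // κ i = c} => Φ i.1)) + 1 :=
  typeRank_sigmaType_add_card_eq_of_pairwise_fiber h κ hκ (pairwise_fiber_of_partialConj h κ hσ)

/-- **Nondegeneracy is decided block by block** when every ordered pair of distinct blocks carries a partial
conjugation: `rank(Σ) = |⊔_i E_i|/2 + 1 ⟺ ∀ c, rank(Σ|_c) = |⊔_{κ i = c} E_i|/2 + 1`.
[cite: Gordon1999HodgeAVSurvey, §3 Theorem and 7.5] [cite: MoonenZarhin1999LowDim, §3 (3.1)] -/
theorem typeRank_sigmaType_eq_iff_forall_fiber_of_partialConj {ρ : G} {Φ : ∀ i, Set (E i)}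
    (h : ∀ i, IsCMTypeWith ρ (Φ i)) (κ : I → C) (hκ : Function.Surjective κ)
    (hσ : ∀ c c', c ≠ c' → ∃ σ : G, (∀ i, κ i = c → ∀ s : E i, σ • s = ρ • s) ∧
      (∀ i, κ i = c' → ∀ s : E i, σ • s = s)) :
    typeRank G (sigmaType Φ) = Fintype.card (Σ i, E i) / 2 + 1 ↔
      ∀ c, typeRank G (sigmaType fun i : {i // κ i = c} => Φ i.1) =
        Fintype.card (Σ i : {i // κ i = c}, E i.1) / 2 + 1 :=
  typeRank_sigmaType_eq_iff_forall_fiber_of_pairwise h κ hκ (pairwise_fiber_of_partialConj h κ hσ)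

end PartialConj

end Literature.NumberTheory.ComplexMultiplication

end
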